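import Mathlib.Tactic.Group
import Mathlib.GroupTheory.Index
import Summits.MatrixMultiplication.MatrixMultiplication.Theses.GelfandPairHosts

/-!
# `AffineCapacity` — the abelian-coset capacity bound for quotient-form designs

Route `MatrixMultiplication/GelfandPairHosts`, item `stmt-MatrixMultiplication-7387` (support):
if `A ≤ G` is an abelian subgroup (acting regularly on `X`), every quotient-form design
`(F, Hs ⊂ G, P ⊂ X)` — `(f'⁻¹ f h⁻¹ h') • p = p' ⇒ f = f', h = h', p = p'` — satisfies
`|F|·|Hs|·|P| ≤ |X|·[G:A]²` (the card's capacity lemma; Cohn–Umans 2003 Lemma 3.1 style pigeonhole).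

Proof.  Fix a section of `G → G ⧸ A` by `Quotient.out` and put `α g := (out (gA))⁻¹ g ∈ A`; two
elements of the same left coset get the same representative, so `(α f')⁻¹ α f = f'⁻¹ f` and
`(α h)⁻¹ α h' = h⁻¹ h'`.  The map `(f, h, p) ↦ (fA, hA, (α f (α h)⁻¹) • p)` from `F × Hs × P` to
`(G ⧸ A) × (G ⧸ A) × X` is injective: equal images give, after moving `α f' (α h')⁻¹` across and
commuting the four `A`-elements (this is where `A` abelian is used),
`(f'⁻¹ f h⁻¹ h') • p = p'`, whence the design condition forces `(f, h, p) = (f', h', p')`.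
Counting gives `|F||Hs||P| ≤ [G:A]²·|X|`.  The regularity hypothesis of the item is not needed.
-/

-- single-conjunct summit: the mandated namespace `Summit.MatrixMultiplication.MatrixMultiplication.…`
-- repeats `MatrixMultiplication` (summit = sub-problem), which `linter.dupNamespace` would flag.
set_option linter.dupNamespace false

namespace Summit.MatrixMultiplication.MatrixMultiplication.Theorems

/-- A coset section of `G → G ⧸ A`: there is `α : G → G` with `α g ∈ A` for all `g` and
`(α g')⁻¹ * α g = g'⁻¹ * g` whenever `g, g'` lie in the same left coset of `A`
(take `α g := (Quotient.out (gA))⁻¹ * g`). [folklore] -/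
theorem affineCapacity_exists_coset_section {G : Type} [Group G] (A : Subgroup G) :
    ∃ α : G → G, (∀ g, α g ∈ A) ∧
      ∀ g g', (QuotientGroup.mk g : G ⧸ A) = QuotientGroup.mk g' → (α g')⁻¹ * α g = g'⁻¹ * g := by
  refine ⟨fun g => ((QuotientGroup.mk g : G ⧸ A).out)⁻¹ * g, fun g => ?_, fun g g' e => ?_⟩
  · rw [← QuotientGroup.eq, QuotientGroup.out_eq']
  · simp only [e, mul_inv_rev, inv_inv]
    group

/-- **Abelian-coset capacity bound** (settles `stmt-MatrixMultiplication-7387`, exact route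
signature `Summit.MatrixMultiplication.MatrixMultiplication.Theses.GelfandPairHosts.AffineCapacity`):
for an abelian subgroup `A ≤ G` (regular on `X`) and a quotient-form design `(F, Hs, P)`,
`|F|·|Hs|·|P| ≤ |X|·[G:A]²`.  Injection `(f, h, p) ↦ (fA, hA, (α f (α h)⁻¹) • p)` into
`(G ⧸ A) × (G ⧸ A) × X`, `α` a coset section; the design condition plus commutativity of `A`
give injectivity (Cohn–Umans 2003, Lemma 3.1, pigeonholed over coset pairs). [folklore] -/
theorem affineCapacity_proof :
    Summit.MatrixMultiplication.MatrixMultiplication.Theses.GelfandPairHosts.AffineCapacity := by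
  unfold Summit.MatrixMultiplication.MatrixMultiplication.Theses.GelfandPairHosts.AffineCapacity
  intro G _ _ X _ _ _ A F Hs P hcomm _hreg hdes
  classical
  obtain ⟨α, hαA, hαq⟩ := affineCapacity_exists_coset_section A
  haveI : Fintype (G ⧸ A) := Fintype.ofFinite (G ⧸ A)
  -- the injection
  let Φ : G × G × X → (G ⧸ A) × (G ⧸ A) × X :=
    fun t => (QuotientGroup.mk t.1, QuotientGroup.mk t.2.1, (α t.1 * (α t.2.1)⁻¹) • t.2.2)
  have hinj : Set.InjOn Φ ↑(F ×ˢ (Hs ×ˢ P)) := by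
    rintro ⟨f, h, p⟩ hm ⟨f', h', p'⟩ hm' heq
    simp only [Finset.coe_product, Set.mem_prod, Finset.mem_coe] at hm hm'
    obtain ⟨hf, hh, hp⟩ := hm
    obtain ⟨hf', hh', hp'⟩ := hm'
    simp only [Φ, Prod.mk.injEq] at heq
    obtain ⟨e1, e2, e3⟩ := heq
    have h1 : (α f')⁻¹ * α f = f'⁻¹ * f := hαq f f' e1
    have h2 : (α h)⁻¹ * α h' = h⁻¹ * h' := hαq h' h e2.symm
    have h3 : ((α f' * (α h')⁻¹)⁻¹ * (α f * (α h)⁻¹)) • p = p' := by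
      rw [mul_smul, e3, ← mul_smul, inv_mul_cancel, one_smul]
    have h4 : (α f' * (α h')⁻¹)⁻¹ * (α f * (α h)⁻¹) = f'⁻¹ * f * h⁻¹ * h' := by
      have c := hcomm (α h') (hαA h') ((α f')⁻¹ * α f * (α h)⁻¹)
        (A.mul_mem (A.mul_mem (A.inv_mem (hαA f')) (hαA f)) (A.inv_mem (hαA h)))
      calc (α f' * (α h')⁻¹)⁻¹ * (α f * (α h)⁻¹)
          = α h' * ((α f')⁻¹ * α f * (α h)⁻¹) := by group
        _ = (α f')⁻¹ * α f * (α h)⁻¹ * α h' := c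
        _ = ((α f')⁻¹ * α f) * ((α h)⁻¹ * α h') := by group
        _ = f'⁻¹ * f * h⁻¹ * h' := by rw [h1, h2]; group
    rw [h4] at h3
    obtain ⟨r1, r2, r3⟩ := hdes f hf f' hf' h hh h' hh' p hp p' hp' h3
    subst r1 r2 r3
    rfl
  have hcardq : Fintype.card (G ⧸ A) = A.index := by
    rw [Subgroup.index, Nat.card_eq_fintype_card]
  calc F.card * Hs.card * P.card
      = (F ×ˢ (Hs ×ˢ P)).card := by rw [Finset.card_product, Finset.card_product, mul_assoc]
    _ = ((F ×ˢ (Hs ×ˢ P)).image Φ).card := (Finset.card_image_of_injOn hinj).symm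
    _ ≤ Fintype.card ((G ⧸ A) × (G ⧸ A) × X) := Finset.card_le_univ _
    _ = Fintype.card X * A.index ^ 2 := by
        rw [Fintype.card_prod, Fintype.card_prod, hcardq]; ring

end Summit.MatrixMultiplication.MatrixMultiplication.Theorems
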